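import Mathlib
import HarnessLib
import Summits.QuantumFields.QCD.Theorems.SpectralDefectExtinctionWindowExtinctionStubLittlewoodOfford

/-!
# Weighted Sperner bound for biased product measures (stub `stub_antichainWeight`)

For independent bits `s_i` with `P(s_i = true) = p_i ∈ [ε, 1 - ε]`, the total weight of any
antichain `𝒜` of the Boolean cube `Fin N → Bool` (coordinatewise order, `false ≤ true`) is at
most `C(ε) / √(N+1)`.  The probability is written as a finite sum over patterns
`s : Fin N → Bool` of product weights.

Proof (the same purely combinatorial "mixture" argument as for the Littlewood–Offord stub S4,
with Sperner's theorem in place of the level-set count): write `p_i = ε + (p_i - ε)` and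
`1 - p_i = ε + (1 - p_i - ε)` and expand the product (`Finset.prod_add`); this exhibits the law
as a mixture over a random set `T` of "fair" coordinates.  Conditionally on `T` and on the
coordinates outside `T`, the section of `𝒜` is an antichain of the cube `T → Bool`, hence by
Sperner's theorem (`IsAntichain.sperner`) has at most `binom(|T|, |T|/2) ≤ 2^|T| / √(|T|+1)`
elements.  Averaging `1/√(|T|+1)` against the binomial law of `|T|` (parameter `2ε`) gives the
claim with `C = 1 + 1/(4ε)`.
-/

noncomputable section

namespace Summit.QuantumFields.QCD.Cruxes.WindowExtinction.FreeVolumeHeavyWitness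

open Finset
open scoped BigOperators

-- adapted from Summits/QuantumFields/QCD/Theorems/
--   SpectralDefectExtinctionWindowExtinctionStubLittlewoodOfford.lean (private helper)
/-- Central binomial bound with the correct polynomial factor:
`(2n+1) · binom(2n,n)² ≤ 16^n`. -/
private theorem aw_centralBinom_sq_bound (n : ℕ) :
    (2 * n + 1) * Nat.centralBinom n ^ 2 ≤ 16 ^ n := by
  induction n with
  | zero => simp
  | succ n ih =>
    have h := Nat.succ_mul_centralBinom_succ n
    have hpos : 0 < (n + 1) ^ 2 := by positivity
    refine Nat.le_of_mul_le_mul_left ?_ hpos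
    have hq : (2 * n + 3) * (2 * n + 1) ≤ 4 * (n + 1) ^ 2 := by nlinarith
    calc (n + 1) ^ 2 * ((2 * (n + 1) + 1) * Nat.centralBinom (n + 1) ^ 2)
        = (2 * n + 3) * ((n + 1) * Nat.centralBinom (n + 1)) ^ 2 := by ring
      _ = 4 * ((2 * n + 3) * (2 * n + 1)) * ((2 * n + 1) * Nat.centralBinom n ^ 2) := by
          rw [h]; ring
      _ ≤ 4 * (4 * (n + 1) ^ 2) * 16 ^ n := by gcongr
      _ = (n + 1) ^ 2 * 16 ^ (n + 1) := by ring

-- adapted from Summits/QuantumFields/QCD/Theorems/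
--   SpectralDefectExtinctionWindowExtinctionStubLittlewoodOfford.lean (private helper)
/-- Middle binomial coefficient bound: `(M+1) · binom(M, ⌊M/2⌋)² ≤ 4^M`. -/
private theorem aw_middle_choose_sq_bound (M : ℕ) :
    (M + 1) * M.choose (M / 2) ^ 2 ≤ 4 ^ M := by
  obtain ⟨n, rfl | rfl⟩ := Nat.even_or_odd' M
  · have h1 : 2 * n / 2 = n := by omega
    rw [h1, ← Nat.centralBinom_eq_two_mul_choose, pow_mul]
    exact aw_centralBinom_sq_bound n
  · have h1 : (2 * n + 1) / 2 = n := by omega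
    rw [h1]
    have h2 : Nat.centralBinom (n + 1) = 2 * (2 * n + 1).choose n := by
      rw [Nat.centralBinom_eq_two_mul_choose, show 2 * (n + 1) = (2 * n + 1) + 1 by ring,
        Nat.choose_succ_succ', Nat.choose_symm_half]
      ring
    have h3 := aw_centralBinom_sq_bound (n + 1)
    rw [h2] at h3
    have h5 : 4 * ((2 * n + 3) * (2 * n + 1).choose n ^ 2) ≤ 4 * 4 ^ (2 * n + 1) := by
      calc 4 * ((2 * n + 3) * (2 * n + 1).choose n ^ 2)
          = (2 * (n + 1) + 1) * (2 * (2 * n + 1).choose n) ^ 2 := by ring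
        _ ≤ 16 ^ (n + 1) := h3
        _ = 4 * 4 ^ (2 * n + 1) := by
          rw [show (16 : ℕ) = 4 ^ 2 by norm_num, ← pow_mul]; ring
    have h6 := Nat.le_of_mul_le_mul_left h5 (by norm_num)
    calc (2 * n + 1 + 1) * (2 * n + 1).choose n ^ 2 ≤ (2 * n + 3) * (2 * n + 1).choose n ^ 2 :=
          Nat.mul_le_mul_right _ (by omega)
      _ ≤ _ := h6

/-- Sperner's theorem in the cube `κ → Bool`: an antichain for the coordinatewise order
(`false ≤ true`) has at most `binom(|κ|, |κ|/2)` elements.  Reduced to `IsAntichain.sperner`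
through the injection `a ↦ {i | a i = true}`. -/
private theorem card_antichain_bool_le (κ : Type*) [Fintype κ] [DecidableEq κ]
    (ℬ : Finset (κ → Bool)) (hℬ : ∀ a ∈ ℬ, ∀ a' ∈ ℬ, (∀ i, a i ≤ a' i) → a = a') :
    #ℬ ≤ (Fintype.card κ).choose (Fintype.card κ / 2) := by
  set φ : (κ → Bool) → Finset κ := fun a => univ.filter (fun i => a i = true) with hφ
  have hmem : ∀ (a : κ → Bool) (i : κ), i ∈ φ a ↔ a i = true := by
    intro a i
    simp [hφ]
  have hinj : Function.Injective φ := by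
    intro a b hab
    funext i
    have := congrArg (i ∈ ·) hab
    exact Bool.eq_iff_iff.mpr (by simpa [hmem] using this)
  have hanti : IsAntichain (· ⊆ ·) ((ℬ.image φ : Finset (Finset κ)) : Set (Finset κ)) := by
    intro A hA B hB hne hAB
    obtain ⟨a, ha, rfl⟩ := Finset.mem_image.1 (Finset.mem_coe.1 hA)
    obtain ⟨b, hb, rfl⟩ := Finset.mem_image.1 (Finset.mem_coe.1 hB)
    have hAB' : φ a ⊆ φ b := hAB
    refine hne (congrArg φ (hℬ a ha b hb (fun i => ?_)))
    rw [Bool.le_iff_imp]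
    intro hai
    exact (hmem b i).1 (hAB' ((hmem a i).2 hai))
  calc #ℬ = #(ℬ.image φ) := (card_image_of_injective ℬ hinj).symm
    _ ≤ _ := hanti.sperner

-- adapted from `sum_filter_prod_sdiff_le` in Summits/QuantumFields/QCD/Theorems/
--   SpectralDefectExtinctionWindowExtinctionStubLittlewoodOfford.lean (private helper)
/-- Conditioning step: if the weight of a pattern only depends on the coordinates outside a
set `T`, then the total weight of an antichain of patterns is at most the middle binomial
coefficient of `|T|` times the total weight of the outside coordinates (the sections of an
antichain with frozen outside coordinates are antichains of the cube `T → Bool`). -/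
private theorem sum_antichain_prod_sdiff_le (N : ℕ) (T : Finset (Fin N)) (r : Fin N → Bool → ℝ)
    (hr : ∀ i b, 0 ≤ r i b) (𝒜 : Finset (Fin N → Bool))
    (h𝒜 : ∀ s ∈ 𝒜, ∀ s' ∈ 𝒜, (∀ i, s i ≤ s' i) → s = s') :
    ∑ s ∈ 𝒜, ∏ i ∈ univ \ T, r i (s i)
      ≤ (T.card.choose (T.card / 2) : ℝ) * ∏ i ∈ univ \ T, (r i true + r i false) := by
  classical
  set e := Equiv.piEquivPiSubtypeProd (· ∈ T) (fun _ : Fin N => Bool) with he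
  have hsub : ∀ x : Fin N, x ∈ univ \ T ↔ ¬ (x ∈ T) := by simp
  have hF : ∀ (a : {x // x ∈ T} → Bool) (b : {x // x ∉ T} → Bool),
      ∏ i ∈ univ \ T, r i (e.symm (a, b) i) = ∏ i : {x // x ∉ T}, r i (b i) := by
    intro a b
    rw [prod_subtype (univ \ T) hsub]
    refine Fintype.prod_congr _ _ (fun i => ?_)
    simp [he, i.2]
  have hG : ∑ b : {x // x ∉ T} → Bool, ∏ i : {x // x ∉ T}, r i (b i)
      = ∏ i ∈ univ \ T, (r i true + r i false) := by
    have h1 := Fintype.prod_sum (fun (i : {x // x ∉ T}) (j : Bool) => r i j)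
    simp only [Fintype.sum_bool] at h1
    rw [prod_subtype (univ \ T) hsub (fun i => r i true + r i false)]
    exact h1.symm
  have hGnn : ∀ b : {x // x ∉ T} → Bool, 0 ≤ ∏ i : {x // x ∉ T}, r i (b i) :=
    fun b => prod_nonneg (fun i _ => hr _ _)
  -- the sections of `𝒜` with frozen outside coordinates are antichains of `T → Bool`
  have hsec : ∀ b : {x // x ∉ T} → Bool,
      ∀ a ∈ (univ : Finset ({x // x ∈ T} → Bool)).filter (fun a => e.symm (a, b) ∈ 𝒜),
        ∀ a' ∈ (univ : Finset ({x // x ∈ T} → Bool)).filter (fun a => e.symm (a, b) ∈ 𝒜),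
          (∀ i, a i ≤ a' i) → a = a' := by
    intro b a ha a' ha' hle
    simp only [mem_filter, mem_univ, true_and] at ha ha'
    have heq : e.symm (a, b) = e.symm (a', b) := by
      refine h𝒜 _ ha _ ha' (fun i => ?_)
      by_cases hi : i ∈ T
      · simpa [he, hi] using hle ⟨i, hi⟩
      · simp [he, hi]
    exact congrArg Prod.fst (e.symm.injective heq)
  have h0 : ∑ s ∈ 𝒜, ∏ i ∈ univ \ T, r i (s i)
      = ∑ s, if s ∈ 𝒜 then ∏ i ∈ univ \ T, r i (s i) else 0 := by
    rw [← sum_filter, filter_univ_mem]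
  rw [h0, ← Equiv.sum_comp e.symm, Fintype.sum_prod_type_right]
  calc ∑ b : {x // x ∉ T} → Bool, ∑ a : {x // x ∈ T} → Bool,
        (if e.symm (a, b) ∈ 𝒜 then ∏ i ∈ univ \ T, r i (e.symm (a, b) i) else 0)
      = ∑ b : {x // x ∉ T} → Bool, ∑ a : {x // x ∈ T} → Bool,
          (if e.symm (a, b) ∈ 𝒜 then ∏ i : {x // x ∉ T}, r i (b i) else 0) := by
        refine Fintype.sum_congr _ _ (fun b => Fintype.sum_congr _ _ (fun a => ?_))
        simp only [hF a b]
    _ = ∑ b : {x // x ∉ T} → Bool, (∏ i : {x // x ∉ T}, r i (b i)) *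
          #((univ : Finset ({x // x ∈ T} → Bool)).filter (fun a => e.symm (a, b) ∈ 𝒜)) := by
        refine Fintype.sum_congr _ _ (fun b => ?_)
        rw [← sum_filter, sum_const, nsmul_eq_mul, mul_comm]
    _ ≤ ∑ b : {x // x ∉ T} → Bool, (∏ i : {x // x ∉ T}, r i (b i)) *
          (T.card.choose (T.card / 2) : ℝ) := by
        refine sum_le_sum (fun b _ => mul_le_mul_of_nonneg_left ?_ (hGnn b))
        have := card_antichain_bool_le {x // x ∈ T} _ (hsec b)
        rw [Fintype.card_coe] at this
        exact_mod_cast this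
    _ = (T.card.choose (T.card / 2) : ℝ) * ∏ i ∈ univ \ T, (r i true + r i false) := by
        rw [← sum_mul, mul_comm, hG]

-- adapted from Summits/QuantumFields/QCD/Theorems/
--   SpectralDefectExtinctionWindowExtinctionStubLittlewoodOfford.lean (private helper)
/-- Real form of the middle binomial bound, linearised in `1/√(M+1)` by AM–GM:
`binom(M, ⌊M/2⌋) ≤ 2^M · (1/(2σ) + σ/(2(M+1)))` for every `σ > 0`. -/
private theorem aw_middle_choose_le (M : ℕ) (σ : ℝ) (hσ : 0 < σ) :
    (M.choose (M / 2) : ℝ) ≤ 2 ^ M * (1 / (2 * σ) + σ / (2 * (M + 1))) := by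
  have h1 : ((M : ℝ) + 1) * (M.choose (M / 2) : ℝ) ^ 2 ≤ ((2 : ℝ) ^ M) ^ 2 := by
    have h := aw_middle_choose_sq_bound M
    have h4 : ((4 : ℝ) ^ M) = ((2 : ℝ) ^ M) ^ 2 := by
      rw [sq, ← mul_pow]; norm_num
    rw [← h4]
    exact_mod_cast h
  set X : ℝ := (M.choose (M / 2) : ℝ) with hX_def
  set P : ℝ := (2 : ℝ) ^ M with hP_def
  have hP : 0 < P := by positivity
  have hM : (0 : ℝ) < (M : ℝ) + 1 := by positivity
  have key : 2 * σ * ((M : ℝ) + 1) * X ≤ P * (σ ^ 2 + ((M : ℝ) + 1)) := by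
    have h2 : (2 * σ * ((M : ℝ) + 1) * X) * P ≤ (P * (σ ^ 2 + ((M : ℝ) + 1))) * P := by
      nlinarith [sq_nonneg (σ * P - ((M : ℝ) + 1) * X),
        mul_le_mul_of_nonneg_left h1 hM.le]
    exact le_of_mul_le_mul_right h2 hP
  have h3 : P * (1 / (2 * σ) + σ / (2 * ((M : ℝ) + 1)))
      = P * (σ ^ 2 + ((M : ℝ) + 1)) / (2 * σ * ((M : ℝ) + 1)) := by
    field_simp
    ring
  rw [h3, le_div_iff₀ (by positivity)]
  linarith [key]

-- adapted from Summits/QuantumFields/QCD/Theorems/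
--   SpectralDefectExtinctionWindowExtinctionStubLittlewoodOfford.lean (private helper)
/-- Binomial average of `1/(M+1)`: for `M ~ Bin(N, q)` one has `(N+1) q · E[1/(M+1)] ≤ 1`,
written as a sum over subsets of `Fin N`. -/
private theorem aw_binomial_inv_succ_sum_le (N : ℕ) (q : ℝ) (hq1 : q ≤ 1) :
    ((N : ℝ) + 1) * q * ∑ T ∈ (univ : Finset (Fin N)).powerset,
        q ^ #T * (1 - q) ^ (N - #T) / (#T + 1) ≤ 1 := by
  have h1 : ∑ T ∈ (univ : Finset (Fin N)).powerset, q ^ #T * (1 - q) ^ (N - #T) / (#T + 1)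
      = ∑ m ∈ range (N + 1), (N.choose m : ℝ) * (q ^ m * (1 - q) ^ (N - m) / (m + 1)) := by
    rw [Finset.sum_powerset_apply_card (fun m => q ^ m * (1 - q) ^ (N - m) / ((m : ℝ) + 1))]
    simp [nsmul_eq_mul]
  have h2 : ∀ m : ℕ, ((N : ℝ) + 1) * (N.choose m : ℝ) / ((m : ℝ) + 1)
      = ((N + 1).choose (m + 1) : ℝ) := by
    intro m
    rw [div_eq_iff (by positivity)]
    exact_mod_cast Nat.add_one_mul_choose_eq N m
  have h3 : ((N : ℝ) + 1) * q * ∑ T ∈ (univ : Finset (Fin N)).powerset,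
        q ^ #T * (1 - q) ^ (N - #T) / (#T + 1)
      = ∑ m ∈ range (N + 1), ((N + 1).choose (m + 1) : ℝ) * (q ^ (m + 1) * (1 - q) ^ (N - m)) := by
    rw [h1, mul_sum]
    refine sum_congr rfl (fun m _ => ?_)
    rw [← h2 m]
    have : (m : ℝ) + 1 ≠ 0 := by positivity
    field_simp
    ring
  have h5 : (0 : ℝ) ≤ ((N + 1).choose 0 : ℝ) * (q ^ 0 * (1 - q) ^ (N + 1 - 0)) :=
    mul_nonneg (by positivity) (mul_nonneg (by positivity) (pow_nonneg (by linarith) _))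
  calc ((N : ℝ) + 1) * q * ∑ T ∈ (univ : Finset (Fin N)).powerset,
        q ^ #T * (1 - q) ^ (N - #T) / (#T + 1)
      = ∑ m ∈ range (N + 1), ((N + 1).choose (m + 1) : ℝ) * (q ^ (m + 1) * (1 - q) ^ (N - m)) := h3
    _ ≤ ∑ m ∈ range (N + 1), ((N + 1).choose (m + 1) : ℝ) * (q ^ (m + 1) * (1 - q) ^ (N - m))
          + ((N + 1).choose 0 : ℝ) * (q ^ 0 * (1 - q) ^ (N + 1 - 0)) := le_add_of_nonneg_right h5
    _ = ∑ m ∈ range (N + 1 + 1), ((N + 1).choose m : ℝ) * (q ^ m * (1 - q) ^ (N + 1 - m)) := by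
        rw [Finset.sum_range_succ'
          (fun m => ((N + 1).choose m : ℝ) * (q ^ m * (1 - q) ^ (N + 1 - m))) (N + 1)]
        simp only [Nat.add_sub_add_right]
    _ = (q + (1 - q)) ^ (N + 1) := by
        rw [add_pow]
        exact sum_congr rfl (fun m _ => by ring)
    _ = 1 := by simp

/-- **Stub `stub_antichainWeight` (weighted Sperner / LYM bound for biased product laws).**
For every `ε > 0` there is `C` such that for independent bits `s_i` with
`P(s_i = true) = p_i ∈ [ε, 1-ε]`, every antichain `𝒜` of the Boolean cube `Fin N → Bool`
(for the coordinatewise order, `false ≤ true`) has total probability at most `C / √(N+1)`;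
here the probability is the finite sum over the patterns in `𝒜` of the product weights.
This generalises the Littlewood–Offord anti-concentration stub `stub_littlewoodOfford`
(level sets of `∑ ±1` are antichains). -/
theorem stub_antichainWeight :
    ∀ ε : ℝ, 0 < ε → ∃ C : ℝ, ∀ (N : ℕ) (p : Fin N → ℝ), (∀ i, ε ≤ p i ∧ p i ≤ 1 - ε) →
      ∀ 𝒜 : Finset (Fin N → Bool), (∀ s ∈ 𝒜, ∀ s' ∈ 𝒜, (∀ i, s i ≤ s' i) → s = s') →
        ∑ s ∈ 𝒜, ∏ i, (if s i then p i else 1 - p i) ≤ C / Real.sqrt (N + 1) := by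
  intro ε hε
  refine ⟨1 + 1 / (4 * ε), fun N p hp 𝒜 h𝒜 => ?_⟩
  have hC1 : (1 : ℝ) ≤ 1 + 1 / (4 * ε) := by
    have : (0 : ℝ) ≤ 1 / (4 * ε) := by positivity
    linarith
  have hw : ∀ (s : Fin N → Bool) (i : Fin N), 0 ≤ (if s i then p i else 1 - p i) := by
    intro s i
    have := hp i
    split <;> linarith [this.1, this.2]
  rcases Nat.eq_zero_or_pos N with rfl | hN
  · -- `N = 0`: the sum has at most one term, equal to `1`.
    have h1 : ∑ s ∈ 𝒜, ∏ i, (if s i then p i else 1 - p i)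
        ≤ ∑ s : Fin 0 → Bool, ∏ i, (if s i then p i else 1 - p i) :=
      sum_le_sum_of_subset_of_nonneg (subset_univ _)
        (fun s _ _ => prod_nonneg (fun i _ => hw s i))
    have h2 : ∑ s : Fin 0 → Bool, ∏ i, (if s i then p i else 1 - p i) = 1 := by simp
    calc _ ≤ (1 : ℝ) := h1.trans h2.le
      _ ≤ (1 + 1 / (4 * ε)) / Real.sqrt ((0 : ℕ) + 1) := by simpa using hC1
  · -- `N ≥ 1`: then `2ε ≤ 1`.
    have hε2 : 2 * ε ≤ 1 := by
      have := hp ⟨0, hN⟩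
      linarith [this.1, this.2]
    set q : ℝ := 2 * ε with hq
    set r : Fin N → Bool → ℝ := fun i b => if b then p i - ε else 1 - p i - ε with hr_def
    have hr : ∀ i b, 0 ≤ r i b := by
      intro i b
      have := hp i
      cases b
      · simp only [hr_def, Bool.false_eq_true, if_false]
        linarith [this.2]
      · simp only [hr_def, if_true]
        linarith [this.1]
    have hr2 : ∀ i, r i true + r i false = 1 - q := by
      intro i
      simp only [hr_def, Bool.false_eq_true, if_false, if_true, hq]
      ring
    have hw' : ∀ s : Fin N → Bool,
        ∏ i, (if s i then p i else 1 - p i) = ∏ i, (ε + r i (s i)) := by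
      intro s
      refine prod_congr rfl (fun i _ => ?_)
      rcases Bool.eq_false_or_eq_true (s i) with h | h
      · simp [h, hr_def]
      · simp [h, hr_def]
    -- Step 1: mixture expansion and exchange of sums.
    have step1 : ∑ s ∈ 𝒜, ∏ i, (if s i then p i else 1 - p i)
        = ∑ T ∈ (univ : Finset (Fin N)).powerset,
            ε ^ #T * ∑ s ∈ 𝒜, ∏ i ∈ univ \ T, r i (s i) := by
      calc ∑ s ∈ 𝒜, ∏ i, (if s i then p i else 1 - p i)
          = ∑ s ∈ 𝒜, ∑ T ∈ (univ : Finset (Fin N)).powerset,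
              ε ^ #T * ∏ i ∈ univ \ T, r i (s i) := by
            refine sum_congr rfl (fun s _ => ?_)
            rw [hw' s, prod_add]
            refine sum_congr rfl (fun T _ => ?_)
            rw [prod_const]
        _ = _ := by
            rw [sum_comm]
            refine sum_congr rfl (fun T _ => ?_)
            rw [mul_sum]
    -- Step 2: conditional bound (Sperner) for each set `T` of fair coordinates.
    have step2 : ∀ T : Finset (Fin N), ∑ s ∈ 𝒜, ∏ i ∈ univ \ T, r i (s i)
        ≤ ((#T).choose (#T / 2) : ℝ) * (1 - q) ^ (N - #T) := by
      intro T
      have := sum_antichain_prod_sdiff_le N T r hr 𝒜 h𝒜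
      rwa [prod_congr rfl (fun i _ => hr2 i), prod_const, Finset.card_univ_sdiff,
        Fintype.card_fin] at this
    -- Step 3: the middle binomial coefficient, linearised with `a = 1/√(N+1)`.
    set σ : ℝ := Real.sqrt (N + 1) with hσ
    have hσpos : 0 < σ := Real.sqrt_pos.2 (by positivity)
    have hσ2 : σ ^ 2 = (N : ℝ) + 1 := Real.sq_sqrt (by positivity)
    have step3 : ∀ T : Finset (Fin N),
        ε ^ #T * (((#T).choose (#T / 2) : ℝ) * (1 - q) ^ (N - #T))
          ≤ (1 / (2 * σ)) * (q ^ #T * (1 - q) ^ (N - #T))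
            + (σ / 2) * (q ^ #T * (1 - q) ^ (N - #T) / (#T + 1)) := by
      intro T
      have hb := aw_middle_choose_le #T σ hσpos
      have h1 : 0 ≤ ε ^ #T * (1 - q) ^ (N - #T) :=
        mul_nonneg (pow_nonneg hε.le _) (pow_nonneg (by linarith) _)
      calc ε ^ #T * (((#T).choose (#T / 2) : ℝ) * (1 - q) ^ (N - #T))
          = (ε ^ #T * (1 - q) ^ (N - #T)) * ((#T).choose (#T / 2) : ℝ) := by ring
        _ ≤ (ε ^ #T * (1 - q) ^ (N - #T))
              * (2 ^ #T * (1 / (2 * σ) + σ / (2 * ((#T : ℝ) + 1)))) :=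
            mul_le_mul_of_nonneg_left hb h1
        _ = _ := by
            rw [hq, mul_pow]
            simp only [← div_div]
            ring
    -- Step 4: the two binomial averages.
    have hsumA : ∑ T ∈ (univ : Finset (Fin N)).powerset, q ^ #T * (1 - q) ^ (N - #T) = 1 := by
      have := Finset.sum_pow_mul_eq_add_pow q (1 - q) (univ : Finset (Fin N))
      rw [card_univ, Fintype.card_fin] at this
      rw [this, hq]
      simp
    have hsumB : ∑ T ∈ (univ : Finset (Fin N)).powerset,
        q ^ #T * (1 - q) ^ (N - #T) / (#T + 1) ≤ 1 / ((N + 1) * q) := by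
      have := aw_binomial_inv_succ_sum_le N q hε2
      rw [le_div_iff₀ (by positivity)]
      calc _ = ((N : ℝ) + 1) * q * ∑ T ∈ (univ : Finset (Fin N)).powerset,
            q ^ #T * (1 - q) ^ (N - #T) / (#T + 1) := by ring
        _ ≤ 1 := this
    -- Assembly.
    calc ∑ s ∈ 𝒜, ∏ i, (if s i then p i else 1 - p i)
        = ∑ T ∈ (univ : Finset (Fin N)).powerset,
            ε ^ #T * ∑ s ∈ 𝒜, ∏ i ∈ univ \ T, r i (s i) := step1
      _ ≤ ∑ T ∈ (univ : Finset (Fin N)).powerset,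
            ε ^ #T * (((#T).choose (#T / 2) : ℝ) * (1 - q) ^ (N - #T)) :=
          sum_le_sum (fun T _ => mul_le_mul_of_nonneg_left (step2 T) (pow_nonneg hε.le _))
      _ ≤ ∑ T ∈ (univ : Finset (Fin N)).powerset,
            ((1 / (2 * σ)) * (q ^ #T * (1 - q) ^ (N - #T))
              + (σ / 2) * (q ^ #T * (1 - q) ^ (N - #T) / (#T + 1))) :=
          sum_le_sum (fun T _ => step3 T)
      _ = (1 / (2 * σ)) * ∑ T ∈ (univ : Finset (Fin N)).powerset, q ^ #T * (1 - q) ^ (N - #T)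
            + (σ / 2) * ∑ T ∈ (univ : Finset (Fin N)).powerset,
                q ^ #T * (1 - q) ^ (N - #T) / (#T + 1) := by
          rw [sum_add_distrib, mul_sum, mul_sum]
      _ ≤ (1 / (2 * σ)) * 1 + (σ / 2) * (1 / ((N + 1) * q)) := by
          rw [hsumA]
          gcongr
      _ = (1 / 2 + 1 / (4 * ε)) / σ := by
          rw [hq, ← hσ2]
          field_simp
          ring
      _ ≤ (1 + 1 / (4 * ε)) / σ := div_le_div_of_nonneg_right (by linarith) hσpos.le

end Summit.QuantumFields.QCD.Cruxes.WindowExtinction.FreeVolumeHeavyWitness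

end
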